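import Literature.Combinatorics.AssociationSchemes.CutMatchingRestrictionStrategies
import HarnessLib

/-!
# Cell pnp-psdrank, route `ChebyshevTracialDesign`: a NON-CROSSING CELL OF A MATRIX STRATEGY is `ρ_π(0)` times the value of the
# REDUCED STRATEGY against the REDUCED DESIGN on `K_{n−|V|}` — so every cell theorem of the tree applies inside a pinned cell
# (crux `TracialDecayExp20`, stmt-PneNP-19878)

Brick 91 (prover g17; MEMO-20 §2(d)/§4: the PINNED cell of the four-part price list). The Literature file
`CutMatchingRestrictionStrategies` (`cell_value_eq_lift`) reads the cell `{U ∈ A : U ∩ V = π} × {M ∈ B : M ⊇ S}` of a matrix strategy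
`(X, Y)` on the reduced strategy `X̃ = X ∘ liftOdd`, `Ỹ = Y ∘ liftPMatch` of `K_m` (`m = n − |V|`) against the SHIFTED LEVEL FUNCTION
`levelFn n t C w (|Ũ| + |π|) (cc Ũ M̃ + y)`; brick 48 (`…NonCrossingCellDesign.noncrossing_cell_eq_reduced_value`) turns the shifted level
function of a NON-CROSSING cell (`y = 0`) of a RECTANGLE into `ρ_π(0)` times the REDUCED DESIGN `w'_c = w_c ρ_π(c)/ρ_π(0)` (exact of degree
`D − s`, `Σ|w'| ≤ Σ|w|`: `reducedDesign_exact`, `reducedDesign_variation_le`; `ρ_π` the level-class ratio polynomial, `cellRatio_eq_eval`). Here the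
two are combined for matrix strategies:
* §1 **`levelFn_shift_eq_reducedDesign`** — pointwise on `OddSet m × PMatch m`: `levelFn n t C w (|Ũ|+|π|) (cc Ũ M̃) = ρ(0)·levelWeight m (t−|π|) C w' (Ũ,M̃)`
  whenever `|Q''_c(m,t−|π|)| = ρ(c)·|Q_c(n,t)|` on `C` and the classes `Q_c(n,t)`, `c ∈ C`, are nonempty;
* §2 **`noncrossing_cell_trace_eq_reduced`** — for ANY families `A`, `B` and ANY matrix-valued `X`, `Y` (dimension `r`):
  `Σ_{U∈A, U∩V=π} Σ_{M∈B, S⊆M} W(U,M)·tr(X_U Y_M) = ρ(0)·Σ_{Ũ∈Ã} Σ_{M̃∈B̃} W'(Ũ,M̃)·tr(X̃_Ũ Ỹ_M̃)`, `W' = levelWeight m (t−|π|) C w'`;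
* §3 **`noncrossing_cell_trace_eq_reduced_univ`** — the whole cell (all `t`-cuts with pattern `π`, all perfect matchings `⊇ S`) is `ρ(0)` times the
  FULL design value of the reduced strategy in `K_m`: `= ρ(0)·Σ_{Ũ ∈ OddSet m} Σ_{M̃ ∈ PM_m} W'(Ũ,M̃)·tr(X̃_Ũ Ỹ_M̃)`; and the consumer shape
  **`noncrossing_cell_trace_le_of_reduced`**: if the reduced strategy (psd contractions when `X, Y` are, `isContractionFamily_lift`; a psd rectangle when
  `(X,Y)` is, `IsPsdRect.lift`) is priced at `β` against the reduced design — by SIGN at any degree (bricks 90/90b), DOMINATION (87d), JUNK/slack (88)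
  or the price list (88c), all stated for arbitrary exact designs — then the cell is priced at `ρ(0)·β ≤ 2ν(⟨S⟩)·β` (`cellRatio_eval_zero_le`).
So the r = 1 rung's reduction step (pin, then recurse in `K_{n−2q}` with a design of degree `D − q` and the same variation) is available BY NAME
for matrix strategies of every dimension; what the matrix programme still lacks is the CHOICE of pins (a Kupavskii–Zakharov step for fields)
and the directional cell count (MEMO-20 §2(d)).
[cite: Rothvoss2017, §2 (PDF p. 6)] [cite: KupavskiiZakharov2022, §2 and Lemma 11] [cite: BrietDadushPokutta2014, Thm. 6 (§3)]
[cite: GriblingDelaatLaurent2019, §5]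
Stature: support/instrument (kernel lane, no defs, axioms standard). WHAT THIS IS NOT: no choice of pins, no proof or refutation of the crux,
nothing on psd rank of P_PM(K_n), no P-vs-NP content. Supports stmt-PneNP-19878.
-/

set_option linter.dupNamespace false -- `Summit.PneNP.PneNP.…`: summit = sub-problem (D-0017)

noncomputable section

namespace Summit.PneNP.PneNP.Theorems.ChebyshevTracialDesignMatrixCellReduction

open Finset Matrix Literature.Combinatorics.Optimization
open Literature.Barriers.PneNP
open Literature.Combinatorics.SetFamily
open Literature.Combinatorics.SimpleGraph.CycleSpace
open Literature.Combinatorics.AssociationSchemes.CutMatchingRestriction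
open Literature.Combinatorics.AssociationSchemes.CutMatchingRestrictionStrategies

variable {n m : ℕ}

/-! ### §1 The shifted level function of a non-crossing cell is `ρ(0)` times the reduced design weight -/

/-- **Shifted level function = `ρ(0)` × reduced design weight**, pointwise. For `|π| ≤ t`, a polynomial `ρ` with `ρ(0) ≠ 0` and
`|Q''_c(m, t−|π|)| = ρ(c)·|Q_c(n,t)|` for `c ∈ C` (brick 48's level-class ratio `ρ_π`), and nonempty `Q_c(n,t)`, `c ∈ C`: for all `Ũ ∈ OddSet m`,
`M̃ ∈ PM_m`, `levelFn n t C w (|Ũ| + |π|) (cc Ũ M̃) = ρ(0) · levelWeight m (t − |π|) C w' (Ũ, M̃)` with `w'_c = w_c ρ(c)/ρ(0)`.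
[cite: Rothvoss2017, §2 (PDF p. 6, eq. (2))] -/
theorem levelFn_shift_eq_reducedDesign {t : ℕ} (C' : Finset ℕ) (w : ℕ → ℝ) {π : Finset (Fin n)} (hp : π.card ≤ t)
    (ρ : Polynomial ℝ) (hρ0 : ρ.eval 0 ≠ 0)
    (hρ : ∀ c ∈ C', ((Qset m (t - π.card) c).card : ℝ) = ρ.eval (c : ℝ) * (Qset n t c).card)
    (hQ : ∀ c ∈ C', (Qset n t c).Nonempty) (Ut : OddSet m) (Mt : PMatch m) :
    levelFn n t C' w (Ut.1.card + π.card) (cc Ut Mt) =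
      ρ.eval 0 * levelWeight m (t - π.card) C' (fun c => w c * ρ.eval (c : ℝ) / ρ.eval 0) Ut Mt := by
  unfold levelFn levelWeight
  rw [mul_sum]
  refine sum_congr rfl fun c hc => ?_
  have hiff : (Ut.1.card + π.card = t ∧ cc Ut Mt = c) ↔ (Ut, Mt) ∈ Qset m (t - π.card) c := by
    rw [mem_Qset_iff]
    show (Ut.1.card + π.card = t ∧ cc Ut Mt = c) ↔ (Ut.1.card = t - π.card ∧ cc Ut Mt = c)
    constructor
    · rintro ⟨h1, h2⟩; exact ⟨by omega, h2⟩
    · rintro ⟨h1, h2⟩; exact ⟨by omega, h2⟩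
  by_cases hmem : (Ut, Mt) ∈ Qset m (t - π.card) c
  · rw [if_pos (hiff.2 hmem), if_pos hmem]
    have hQpos : (0 : ℝ) < (Qset n t c).card := by exact_mod_cast card_pos.2 (hQ c hc)
    have hQ''pos : (0 : ℝ) < (Qset m (t - π.card) c).card := by exact_mod_cast card_pos.2 ⟨_, hmem⟩
    have hρc : ρ.eval (c : ℝ) ≠ 0 := by
      intro h0
      rw [hρ c hc, h0, zero_mul] at hQ''pos
      exact lt_irrefl _ hQ''pos
    rw [hρ c hc]
    field_simp
  · rw [if_neg (fun h' => hmem (hiff.1 h')), if_neg hmem, mul_zero]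

/-! ### §2 Non-crossing cells of a matrix strategy against the reduced design -/

/-- **A NON-CROSSING CELL OF A MATRIX STRATEGY = `ρ(0)` × THE REDUCED STRATEGY AGAINST THE REDUCED DESIGN.** For a planted weight
`W = levelWeight n t C w`, a core `S` (perfect matching of `V`), an even NON-CROSSING pattern `π ⊆ V` (`crossCount π S = 0`, `|π| ≤ t`),
`m = n − |V|`, the ratio polynomial `ρ` of §1, families `A` of odd cuts and `B` of perfect matchings, and ANY matrix-valued `X`, `Y` (dimension `r`):
`Σ_{U∈A, U∩V=π} Σ_{M∈B, S⊆M} W(U,M)·tr(X_U Y_M) = ρ(0)·Σ_{Ũ∈Ã} Σ_{M̃∈B̃} levelWeight m (t−|π|) C w' (Ũ,M̃)·tr(X(liftOdd Ũ)·Y(liftPMatch M̃))`.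
(Brick 48 is the rectangle case.) [cite: Rothvoss2017, §2 (PDF p. 6)] [cite: KupavskiiZakharov2022, §2 and Lemma 11] -/
theorem noncrossing_cell_trace_eq_reduced {t r : ℕ} (C' : Finset ℕ) (w : ℕ → ℝ) {V π : Finset (Fin n)} {S : Finset (Sym2 (Fin n))}
    (hS : IsPMOn V S) (h : (univ \ V).card = m) (hπ : π ⊆ V) (hπe : Even π.card) (hπ0 : crossCount π S = 0) (hp : π.card ≤ t)
    (ρ : Polynomial ℝ) (hρ0 : ρ.eval 0 ≠ 0)
    (hρ : ∀ c ∈ C', ((Qset m (t - π.card) c).card : ℝ) = ρ.eval (c : ℝ) * (Qset n t c).card)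
    (hQ : ∀ c ∈ C', (Qset n t c).Nonempty)
    (X : OddSet n → Matrix (Fin r) (Fin r) ℝ) (Y : PMatch n → Matrix (Fin r) (Fin r) ℝ) (A : Finset (OddSet n)) (B : Finset (PMatch n)) :
    ∑ U ∈ A.filter (fun U => U.1 ∩ V = π), ∑ M ∈ B.filter (fun M => S ⊆ M.1), levelWeight n t C' w U M * (X U * Y M).trace =
      ρ.eval 0 * ∑ Ut ∈ oddCellCuts A V π h, ∑ Mt ∈ pmCellMatchings B V S h,
        levelWeight m (t - π.card) C' (fun c => w c * ρ.eval (c : ℝ) / ρ.eval 0) Ut Mt *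
          (X (liftOdd V π h hπ hπe Ut) * Y (liftPMatch V S h hS Mt)).trace := by
  rw [cell_value_eq_lift hS h hπ hπe t C' w X Y A B, mul_sum]
  refine sum_congr rfl fun Ut _ => ?_
  rw [mul_sum]
  refine sum_congr rfl fun Mt _ => ?_
  rw [hπ0, add_zero, levelFn_shift_eq_reducedDesign C' w hp ρ hρ0 hρ hQ Ut Mt, mul_assoc]

/-! ### §3 The whole cell, and the consumer shape -/

/-- The reduced design weight vanishes off the `(t − |π|)`-cuts. [cite: Rothvoss2017, §2 (PDF p. 6, eq. (2))] -/
theorem levelWeight_eq_zero_of_card_ne {t' : ℕ} (C' : Finset ℕ) (w' : ℕ → ℝ) (Ut : OddSet m) (Mt : PMatch m) (hU : Ut.1.card ≠ t') :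
    levelWeight m t' C' w' Ut Mt = 0 := by
  unfold levelWeight
  refine sum_eq_zero fun c _ => ?_
  rw [if_neg]
  rw [mem_Qset_iff]
  exact fun h => hU h.1

/-- **THE WHOLE NON-CROSSING CELL IS `ρ(0)` × THE FULL REDUCED DESIGN VALUE.** With `A` = all `t`-cuts and `B` = all perfect matchings:
`Σ_{|U|=t, U∩V=π} Σ_{M ⊇ S} W(U,M)·tr(X_U Y_M) = ρ(0)·Σ_{Ũ ∈ OddSet m} Σ_{M̃ ∈ PM_m} levelWeight m (t−|π|) C w' (Ũ,M̃)·tr(X̃_Ũ Ỹ_M̃)` — the design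
value, in the reduced instance `K_m`, of the reduced strategy `X̃ = X ∘ liftOdd`, `Ỹ = Y ∘ liftPMatch` (`t` odd).
[cite: Rothvoss2017, §2 (PDF p. 6)] [cite: KupavskiiZakharov2022, §2 and Lemma 11] -/
theorem noncrossing_cell_trace_eq_reduced_univ {t r : ℕ} (ht : Odd t) (C' : Finset ℕ) (w : ℕ → ℝ) {V π : Finset (Fin n)}
    {S : Finset (Sym2 (Fin n))} (hS : IsPMOn V S) (h : (univ \ V).card = m) (hπ : π ⊆ V) (hπe : Even π.card) (hπ0 : crossCount π S = 0)
    (hp : π.card ≤ t) (ρ : Polynomial ℝ) (hρ0 : ρ.eval 0 ≠ 0)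
    (hρ : ∀ c ∈ C', ((Qset m (t - π.card) c).card : ℝ) = ρ.eval (c : ℝ) * (Qset n t c).card)
    (hQ : ∀ c ∈ C', (Qset n t c).Nonempty)
    (X : OddSet n → Matrix (Fin r) (Fin r) ℝ) (Y : PMatch n → Matrix (Fin r) (Fin r) ℝ) :
    ∑ U ∈ (univ.filter fun U : OddSet n => U.1.card = t).filter (fun U => U.1 ∩ V = π),
        ∑ M ∈ (univ : Finset (PMatch n)).filter (fun M => S ⊆ M.1), levelWeight n t C' w U M * (X U * Y M).trace =
      ρ.eval 0 * ∑ Ut : OddSet m, ∑ Mt : PMatch m,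
        levelWeight m (t - π.card) C' (fun c => w c * ρ.eval (c : ℝ) / ρ.eval 0) Ut Mt *
          (X (liftOdd V π h hπ hπe Ut) * Y (liftPMatch V S h hS Mt)).trace := by
  rw [noncrossing_cell_trace_eq_reduced C' w hS h hπ hπe hπ0 hp ρ hρ0 hρ hQ X Y, oddCellCuts_univ_filter hπ h hp ht,
    pmCellMatchings_univ hS h]
  congr 1
  rw [sum_filter]
  refine sum_congr rfl fun Ut _ => ?_
  split_ifs with hU
  · rfl
  · symm
    exact sum_eq_zero fun Mt _ => by rw [levelWeight_eq_zero_of_card_ne C' _ Ut Mt hU, zero_mul]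

/-- **CONSUMER SHAPE: a non-crossing pinned cell is priced by the reduced instance.** If the reduced strategy is priced at `β` against the
reduced design in `K_m` — `Σ_{Ũ,M̃} levelWeight m (t−|π|) C w' (Ũ,M̃)·tr(X̃_Ũ Ỹ_M̃) ≤ β`, by any cell theorem of the tree (the reduced strategy
is a family of psd contractions if `(X,Y)` is, `isContractionFamily_lift`; the reduced design is exact of degree `D − deg ρ` with the same variation,
brick 48) — and `ρ(0) > 0`, then the cell is priced at `ρ(0)·β`. [cite: Rothvoss2017, §2 (PDF p. 6)] [cite: KupavskiiZakharov2022, §2 and Lemma 11]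
[cite: GriblingDelaatLaurent2019, §5] -/
theorem noncrossing_cell_trace_le_of_reduced {t r : ℕ} (ht : Odd t) (C' : Finset ℕ) (w : ℕ → ℝ) {V π : Finset (Fin n)}
    {S : Finset (Sym2 (Fin n))} (hS : IsPMOn V S) (h : (univ \ V).card = m) (hπ : π ⊆ V) (hπe : Even π.card) (hπ0 : crossCount π S = 0)
    (hp : π.card ≤ t) (ρ : Polynomial ℝ) (hρ0 : 0 < ρ.eval 0)
    (hρ : ∀ c ∈ C', ((Qset m (t - π.card) c).card : ℝ) = ρ.eval (c : ℝ) * (Qset n t c).card)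
    (hQ : ∀ c ∈ C', (Qset n t c).Nonempty)
    (X : OddSet n → Matrix (Fin r) (Fin r) ℝ) (Y : PMatch n → Matrix (Fin r) (Fin r) ℝ) {β : ℝ}
    (hred : ∑ Ut : OddSet m, ∑ Mt : PMatch m,
        levelWeight m (t - π.card) C' (fun c => w c * ρ.eval (c : ℝ) / ρ.eval 0) Ut Mt *
          (X (liftOdd V π h hπ hπe Ut) * Y (liftPMatch V S h hS Mt)).trace ≤ β) :
    ∑ U ∈ (univ.filter fun U : OddSet n => U.1.card = t).filter (fun U => U.1 ∩ V = π),
        ∑ M ∈ (univ : Finset (PMatch n)).filter (fun M => S ⊆ M.1), levelWeight n t C' w U M * (X U * Y M).trace ≤ ρ.eval 0 * β := by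
  rw [noncrossing_cell_trace_eq_reduced_univ ht C' w hS h hπ hπe hπ0 hp ρ hρ0.ne' hρ hQ X Y]
  exact mul_le_mul_of_nonneg_left hred hρ0.le

end Summit.PneNP.PneNP.Theorems.ChebyshevTracialDesignMatrixCellReduction

end
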